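import Summits.CriticalPhenomena.PercolationContinuityZ3.Theorems.PercNearOneGluingNoHeavyLowerTailCILBlobsNoLightPair
import HarnessLib

/-!
# `NoHeavyLowerTail` (stmt-CriticalPhenomena-4575) — the cumulative isolation lemma on blob structures, II:
# EVERY blob structure with at most four blobs, every `|A|`, every level

Support file (depth prover nh-dp-blobmono; `--supports stmt-CriticalPhenomena-4575`).  No definitions, no
named facts, no sorries.  Notation as in part I (`…CILBlobsNoLightPair`): `N`, `π(a)`, blob structure
`cls`, masses `m_ℓ`, level `j`, light = mass `≤ j`.

* `CILBlobs.twoLightPairs_subset` — relay labels among `p, q, r`, `{p,q}` and `{p,r}` light: on the good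
  set `{1 ≤ N ≤ j} ⊆ {|π(a_p)| ≤ j}` pointwise.
* `CILBlobs.oneLightPair_le` — exactly one light pair `{p,q}` (`{p,r}`, `{q,r}` heavy): the minority event
  lies in the two-cut master event `({a↮c} ∩ {b↮c}) ∪ oa|bc ∪ ob|ac` of `Theorems.twoCutMaster_le_max`
  (tripod exchange C⁺ = van den Berg–Häggström–Kahn Thm 1.5 ×4), so `μ{1 ≤ N ≤ j} ≤ max(μ{a↮c}, μ{b↮c})
  ≤ max(μ{|π(a)| ≤ j}, μ{|π(b)| ≤ j})`.
* `cumulativeIsolation_fourBlobs` / `cumulativeIsolation_blobs_le_four` — the conclusion of the registered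
  stub `stub_cumulativeIsolation` on every blob structure with `b ≤ 4` labels: observer glued to a relay
  (`cil_of_glued`), or observer-free with no light pair (`cumulativeIsolation_blobs_noLightPair`, KN
  Lemma 2 for blocks), two light pairs (pointwise), one light pair (C⁺).

So on ≤ 4 blobs the weighted CIL needs exactly the one-cut tools (`…TwoCutMaster`) plus KN Lemma 2 for
blocks — in particular it holds for the threshold families "all pairs through the lightest blob" and "the two
light blobs and their union", which are not of the form `{|S| ≤ j}`.  Five blobs: the majority-blob family
`{S ⊆ {p,q,r}}` is the three-relay E-form of `AdditiveGluing` (stmt-4576); the remaining families are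
recorded in the crux notes (blob-CIL report).
-/

noncomputable section

namespace Summit.CriticalPhenomena.PercolationContinuityZ3.Theorems

open MeasureTheory Set Literature.Probability.LatticeModels Literature.Probability.Percolation
open scoped Classical BigOperators

variable {n : ℕ}

namespace CILBlobs

/-- **Two light pairs through one blob: pointwise containment.**  If the relay labels are among
`p, q, r` and both `{p,q}` and `{p,r}` are light (`m_p + m_q ≤ j`, `m_p + m_r ≤ j`), then on the good set
`{1 ≤ N ≤ j} ⊆ {|π(a)| ≤ j}` for every relay `a` of blob `p`: if `o ↔ a` then `π(a) = π(o)`; otherwise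
`o` holds a relay of blob `q` or `r`, which `π(a)` then avoids, so `π(a)` lies in two light blobs.
[folklore] -/
theorem twoLightPairs_subset {b : ℕ} (A : Finset (Fin n)) (o : Fin n) (j : ℕ) (cls : Fin n → Fin b)
    (p q r : Fin b) (hlab : ∀ a ∈ A, cls a = p ∨ cls a = q ∨ cls a = r)
    (hpq : (A.filter fun a => cls a = p).card + (A.filter fun a => cls a = q).card ≤ j)
    (hpr : (A.filter fun a => cls a = p).card + (A.filter fun a => cls a = r).card ≤ j)
    {a : Fin n} (ha : a ∈ A) (hca : cls a = p) :
    {ω : BondConfig (Fin n) | 1 ≤ (A.filter fun y => ω ∈ openConn o y).card ∧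
        (A.filter fun y => ω ∈ openConn o y).card ≤ j} ∩
      {ω : BondConfig (Fin n) | ∀ u ∈ insert o A, ∀ v ∈ insert o A,
        cls u = cls v → (openGraph ω).Reachable u v} ⊆
      {ω : BondConfig (Fin n) | (A.filter fun y => ω ∈ openConn a y).card ≤ j} := by
  rintro ω ⟨⟨h1, hj⟩, hωG⟩
  show (A.filter fun y => ω ∈ openConn a y).card ≤ j
  by_cases hoa : (openGraph ω).Reachable o a
  · rw [piCard_eq_of_reachable A o a ω hoa]; exact hj
  obtain ⟨a₀, ha₀⟩ := Finset.card_pos.1 (by omega : 0 < (A.filter fun y => ω ∈ openConn o y).card)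
  obtain ⟨ha₀A, hoa₀⟩ := Finset.mem_filter.1 ha₀
  have hoa₀' : (openGraph ω).Reachable o a₀ := hoa₀
  have haa₀ : ¬ (openGraph ω).Reachable a a₀ := fun h => hoa (hoa₀'.trans h.symm)
  have havoid := pi_avoids_label A o cls ω hωG ha₀A haa₀
  have hp : cls a₀ ≠ p := fun h =>
    haa₀ (hωG a (Finset.mem_insert_of_mem ha) a₀ (Finset.mem_insert_of_mem ha₀A) (hca.trans h.symm))
  rcases hlab a₀ ha₀A with h0 | h0 | h0
  · exact absurd h0 hp
  · -- `o` holds blob `q`: `π(a) ⊆ B_p ∪ B_r`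
    have hsub : (A.filter fun y => ω ∈ openConn a y) ⊆
        (A.filter fun a => cls a = p) ∪ (A.filter fun a => cls a = r) := by
      intro x hx
      have hxA := (Finset.mem_filter.1 hx).1
      have hxq : cls x ≠ q := h0 ▸ havoid x hx
      rcases hlab x hxA with h' | h' | h'
      · exact Finset.mem_union_left _ (Finset.mem_filter.2 ⟨hxA, h'⟩)
      · exact absurd h' hxq
      · exact Finset.mem_union_right _ (Finset.mem_filter.2 ⟨hxA, h'⟩)
    exact le_trans (Finset.card_le_card hsub) (le_trans (Finset.card_union_le _ _) hpr)
  · -- `o` holds blob `r`: `π(a) ⊆ B_p ∪ B_q`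
    have hsub : (A.filter fun y => ω ∈ openConn a y) ⊆
        (A.filter fun a => cls a = p) ∪ (A.filter fun a => cls a = q) := by
      intro x hx
      have hxA := (Finset.mem_filter.1 hx).1
      have hxr : cls x ≠ r := h0 ▸ havoid x hx
      rcases hlab x hxA with h' | h' | h'
      · exact Finset.mem_union_left _ (Finset.mem_filter.2 ⟨hxA, h'⟩)
      · exact Finset.mem_union_right _ (Finset.mem_filter.2 ⟨hxA, h'⟩)
      · exact absurd h' hxr
    exact le_trans (Finset.card_le_card hsub) (le_trans (Finset.card_union_le _ _) hpq)

/-- **Exactly one light pair: the two-cut master event.**  Relay labels among `p, q, r` (`r ≠ p, q`),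
`{p,q}` light, `{p,r}` and `{q,r}` heavy, representatives `a, b, c` of the three blobs.  On the good set
the minority event lies in `({a↮c} ∩ {b↮c}) ∪ oa|bc ∪ ob|ac` (if `o ↔ c` it cannot also hold `a` or `b`;
otherwise it holds `a` or `b` and misses `c`, `Theorems.lonelyOrPair_subset_master`), so by
`Theorems.twoCutMaster_le_max` (tripod exchange C⁺) `μ{1 ≤ N ≤ j} ≤ max(μ{a↮c}, μ{b↮c})`, and
`{a↮c} ⊆ {|π(a)| ≤ j}`, `{b↮c} ⊆ {|π(b)| ≤ j}` a.s. (a relay cut from `c` sees only the light pair).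
[cite: VandenbergHaggstromKahn2005, Thm. 1.5 — via tripodExchange / twoCutMaster_le_max] -/
theorem oneLightPair_le {b : ℕ} (w : Sym2 (Fin n) → unitInterval) (A : Finset (Fin n)) (o : Fin n)
    (j : ℕ) (cls : Fin n → Fin b)
    (hcls : ∀ u ∈ insert o A, ∀ v ∈ insert o A, cls u = cls v →
      (prodBernoulli w).real (openConn u v)ᶜ = 0)
    (p q r : Fin b) (hpr : p ≠ r) (hqr : q ≠ r)
    (hlab : ∀ a ∈ A, cls a = p ∨ cls a = q ∨ cls a = r)
    (hpq : (A.filter fun a => cls a = p).card + (A.filter fun a => cls a = q).card ≤ j)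
    (hpr' : j < (A.filter fun a => cls a = p).card + (A.filter fun a => cls a = r).card)
    (hqr' : j < (A.filter fun a => cls a = q).card + (A.filter fun a => cls a = r).card)
    {a b' c : Fin n} (ha : a ∈ A) (hca : cls a = p) (hb : b' ∈ A) (hcb : cls b' = q)
    (hc : c ∈ A) (hcc : cls c = r) :
    (prodBernoulli w).real {ω : BondConfig (Fin n) |
        1 ≤ (A.filter fun y => ω ∈ openConn o y).card ∧
          (A.filter fun y => ω ∈ openConn o y).card ≤ j} ≤
      max ((prodBernoulli w).real {ω : BondConfig (Fin n) |
            (A.filter fun y => ω ∈ openConn a y).card ≤ j})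
        ((prodBernoulli w).real {ω : BondConfig (Fin n) |
            (A.filter fun y => ω ∈ openConn b' y).card ≤ j}) := by
  set μ := prodBernoulli w with hμ
  set L := {ω : BondConfig (Fin n) | 1 ≤ (A.filter fun y => ω ∈ openConn o y).card ∧
    (A.filter fun y => ω ∈ openConn o y).card ≤ j} with hL
  set G := {ω : BondConfig (Fin n) | ∀ u ∈ insert o A, ∀ v ∈ insert o A,
      cls u = cls v → (openGraph ω).Reachable u v} with hG
  set M : Set (BondConfig (Fin n)) :=
    (((openConn a c)ᶜ ∩ (openConn b' c)ᶜ) ∪ (openConn o a ∩ openConn b' c ∩ (openConn a b')ᶜ)) ∪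
      (openConn o b' ∩ openConn a c ∩ (openConn a b')ᶜ) with hM
  -- step 1: the minority event lies in the master event
  have hLM : L ∩ G ⊆ M := by
    rintro ω ⟨⟨h1, hj⟩, hωG⟩
    by_cases hoc : (openGraph ω).Reachable o c
    · refine Or.inl (Or.inl ⟨fun hac => ?_, fun hbc => ?_⟩)
      · have hac' : (openGraph ω).Reachable a c := hac
        have hoa : (openGraph ω).Reachable o a := hoc.trans hac'.symm
        have h2 := blobs_count_ge_two A o cls ω hωG ha hc hoa hoc (by rw [hca, hcc]; exact hpr)
        rw [hca, hcc] at h2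
        omega
      · have hbc' : (openGraph ω).Reachable b' c := hbc
        have hob : (openGraph ω).Reachable o b' := hoc.trans hbc'.symm
        have h2 := blobs_count_ge_two A o cls ω hωG hb hc hob hoc (by rw [hcb, hcc]; exact hqr)
        rw [hcb, hcc] at h2
        omega
    · obtain ⟨a₀, ha₀⟩ := Finset.card_pos.1 (by omega : 0 < (A.filter fun y => ω ∈ openConn o y).card)
      obtain ⟨ha₀A, hoa₀⟩ := Finset.mem_filter.1 ha₀
      have hoa₀' : (openGraph ω).Reachable o a₀ := hoa₀
      have hoc' : ω ∈ (openConn o c : Set (BondConfig (Fin n)))ᶜ := hoc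
      rcases hlab a₀ ha₀A with h0 | h0 | h0
      · have hoa : (openGraph ω).Reachable o a := hoa₀'.trans
          (hωG a₀ (Finset.mem_insert_of_mem ha₀A) a (Finset.mem_insert_of_mem ha) (h0.trans hca.symm))
        exact lonelyOrPair_subset_master o a b' c ⟨hoc', Or.inl hoa⟩
      · have hob : (openGraph ω).Reachable o b' := hoa₀'.trans
          (hωG a₀ (Finset.mem_insert_of_mem ha₀A) b' (Finset.mem_insert_of_mem hb) (h0.trans hcb.symm))
        exact lonelyOrPair_subset_master o a b' c ⟨hoc', Or.inr hob⟩
      · exact absurd (hoa₀'.trans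
          (hωG a₀ (Finset.mem_insert_of_mem ha₀A) c (Finset.mem_insert_of_mem hc) (h0.trans hcc.symm))) hoc
  have hLle : μ.real L ≤ μ.real M := oneCut_of_blobs_trap w A o _ cls hcls L M hLM le_rfl
  -- step 2: the two cuts lie in the light events
  have hcut : ∀ {x : Fin n}, x ∈ A → (cls x = p ∨ cls x = q) →
      μ.real (openConn x c : Set (BondConfig (Fin n)))ᶜ ≤
        μ.real {ω : BondConfig (Fin n) | (A.filter fun y => ω ∈ openConn x y).card ≤ j} := by
    intro x hx hcx
    refine oneCut_of_blobs_trap w A o _ cls hcls _ _ (fun ω hω => ?_) le_rfl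
    obtain ⟨hxc, hωG⟩ := hω
    have hxc' : ¬ (openGraph ω).Reachable x c := hxc
    have havoid := pi_avoids_label A o cls ω hωG hc hxc'
    show (A.filter fun y => ω ∈ openConn x y).card ≤ j
    have hsub : (A.filter fun y => ω ∈ openConn x y) ⊆
        (A.filter fun a => cls a = p) ∪ (A.filter fun a => cls a = q) := by
      intro y hy
      have hyA := (Finset.mem_filter.1 hy).1
      have hyr : cls y ≠ r := hcc ▸ havoid y hy
      rcases hlab y hyA with h' | h' | h'
      · exact Finset.mem_union_left _ (Finset.mem_filter.2 ⟨hyA, h'⟩)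
      · exact Finset.mem_union_right _ (Finset.mem_filter.2 ⟨hyA, h'⟩)
      · exact absurd h' hyr
    exact le_trans (Finset.card_le_card hsub) (le_trans (Finset.card_union_le _ _) hpq)
  calc μ.real L ≤ μ.real M := hLle
    _ ≤ max (μ.real (openConn a c : Set (BondConfig (Fin n)))ᶜ)
          (μ.real (openConn b' c : Set (BondConfig (Fin n)))ᶜ) := twoCutMaster_le_max w o a b' c
    _ ≤ _ := max_le_max (hcut ha (Or.inl hca)) (hcut hb (Or.inr hcb))

end CILBlobs

open CILBlobs in
/-- **The cumulative isolation lemma on every blob structure with at most four blobs** — every `|A|`,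
every level `j`: with the blob structure `cls : Fin n → Fin 4` (same label on `insert o A` ⇒ joined a.s.),
some relay `a ∈ A` has `μ{1 ≤ N ≤ j} ≤ μ{|π(a)| ≤ j}` — the conclusion of the registered stub
`stub_cumulativeIsolation`, for integer-weighted relays in at most three relay blobs.  Observer glued to a
relay: `cil_of_glued`.  Observer-free: no light pair ⇒ `cumulativeIsolation_blobs_noLightPair` (KN Lemma 2
for blocks); a light pair plus a second light pair through the same blob ⇒ `twoLightPairs_subset`
(pointwise); exactly one light pair ⇒ `oneLightPair_le` (tripod exchange C⁺).
[cite: KozmaNitzan2024, Lemma 2 (p. 6); VandenbergHaggstromKahn2005, Thms. 1.3, 1.5] -/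
theorem cumulativeIsolation_fourBlobs :
    ∀ (n : ℕ) (w : Sym2 (Fin n) → unitInterval) (A : Finset (Fin n)) (o : Fin n) (j : ℕ)
      (cls : Fin n → Fin 4),
      (∀ u ∈ insert o A, ∀ v ∈ insert o A, cls u = cls v →
        (Literature.Probability.LatticeModels.prodBernoulli w).real
          (Literature.Probability.Percolation.openConn u v)ᶜ = 0) →
      A.Nonempty →
      ∃ a ∈ A,
        (Literature.Probability.LatticeModels.prodBernoulli w).real
            {ω : Literature.Probability.Percolation.BondConfig (Fin n) |
              1 ≤ (A.filter fun x => ω ∈ Literature.Probability.Percolation.openConn o x).card ∧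
                (A.filter fun x => ω ∈ Literature.Probability.Percolation.openConn o x).card ≤ j} ≤
          (Literature.Probability.LatticeModels.prodBernoulli w).real
            {ω : Literature.Probability.Percolation.BondConfig (Fin n) |
              (A.filter fun x => ω ∈ Literature.Probability.Percolation.openConn a x).card ≤ j} := by
  intro n w A o j cls hcls hA
  set μ := prodBernoulli w with hμ
  set L := {ω : BondConfig (Fin n) | 1 ≤ (A.filter fun y => ω ∈ openConn o y).card ∧
    (A.filter fun y => ω ∈ openConn o y).card ≤ j} with hL
  by_cases hobs : ∃ x ∈ A, cls x = cls o
  · obtain ⟨x, hx, hcx⟩ := hobs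
    exact ⟨x, hx, cil_of_glued w A o x j
      (hcls o (Finset.mem_insert_self _ _) x (Finset.mem_insert_of_mem hx) hcx.symm)⟩
  push Not at hobs
  by_cases hlp : ∃ ℓ ℓ' : Fin 4, ℓ ≠ ℓ' ∧ (A.filter fun a => cls a = ℓ).Nonempty ∧
      (A.filter fun a => cls a = ℓ').Nonempty ∧
      (A.filter fun a => cls a = ℓ).card + (A.filter fun a => cls a = ℓ').card ≤ j
  · obtain ⟨ℓ, ℓ', hne, ⟨a, ha⟩, ⟨b', hb'⟩, hlight⟩ := hlp
    obtain ⟨haA, hca⟩ := Finset.mem_filter.1 ha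
    obtain ⟨hb'A, hcb'⟩ := Finset.mem_filter.1 hb'
    have hℓo : ℓ ≠ cls o := fun h => hobs a haA (hca.trans h)
    have hℓ'o : ℓ' ≠ cls o := fun h => hobs b' hb'A (hcb'.trans h)
    -- the third non-observer label
    have key : ∀ (i x y z : Fin 4), x ≠ i → y ≠ i → x ≠ y → z ≠ i →
        (z = x ∨ z = y ∨ z = 2 - i - x - y) := by decide
    have key2 : ∀ (i x y : Fin 4), x ≠ i → y ≠ i → x ≠ y →
        (x ≠ 2 - i - x - y ∧ y ≠ 2 - i - x - y) := by decide
    set ℓ'' : Fin 4 := 2 - cls o - ℓ - ℓ' with hℓ''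
    have hlab : ∀ x ∈ A, cls x = ℓ ∨ cls x = ℓ' ∨ cls x = ℓ'' :=
      fun x hx => key (cls o) ℓ ℓ' (cls x) hℓo hℓ'o hne (hobs x hx)
    obtain ⟨h1, h2⟩ := key2 (cls o) ℓ ℓ' hℓo hℓ'o hne
    by_cases hM : A.card ≤ j
    · exact ⟨a, haA, measureReal_mono fun ω _ => le_trans (Finset.card_filter_le _ _) hM⟩
    have hr : (A.filter fun a => cls a = ℓ'').Nonempty := by
      by_contra hemp
      rw [Finset.not_nonempty_iff_eq_empty] at hemp
      apply hM
      have hsub : A ⊆ (A.filter fun a => cls a = ℓ) ∪ (A.filter fun a => cls a = ℓ') := by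
        intro x hx
        rcases hlab x hx with h | h | h
        · exact Finset.mem_union_left _ (Finset.mem_filter.2 ⟨hx, h⟩)
        · exact Finset.mem_union_right _ (Finset.mem_filter.2 ⟨hx, h⟩)
        · have : x ∈ (A.filter fun a => cls a = ℓ'') := Finset.mem_filter.2 ⟨hx, h⟩
          rw [hemp] at this
          exact absurd this (Finset.notMem_empty x)
      exact le_trans (Finset.card_le_card hsub) (le_trans (Finset.card_union_le _ _) hlight)
    obtain ⟨c, hc⟩ := hr
    obtain ⟨hcA, hcc⟩ := Finset.mem_filter.1 hc
    by_cases hP : (A.filter fun a => cls a = ℓ).card + (A.filter fun a => cls a = ℓ'').card ≤ j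
    · exact ⟨a, haA, oneCut_of_blobs_trap w A o _ cls hcls L _
        (twoLightPairs_subset A o j cls ℓ ℓ' ℓ'' hlab hlight hP haA hca) le_rfl⟩
    by_cases hQ : (A.filter fun a => cls a = ℓ').card + (A.filter fun a => cls a = ℓ'').card ≤ j
    · have hlab' : ∀ x ∈ A, cls x = ℓ' ∨ cls x = ℓ ∨ cls x = ℓ'' := fun x hx => by
        rcases hlab x hx with h | h | h
        · exact Or.inr (Or.inl h)
        · exact Or.inl h
        · exact Or.inr (Or.inr h)
      exact ⟨b', hb'A, oneCut_of_blobs_trap w A o _ cls hcls L _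
        (twoLightPairs_subset A o j cls ℓ' ℓ ℓ'' hlab' (by rwa [add_comm]) hQ hb'A hcb') le_rfl⟩
    push Not at hP hQ
    have hD := oneLightPair_le w A o j cls hcls ℓ ℓ' ℓ'' h1 h2 hlab hlight hP hQ haA hca hb'A hcb' hcA hcc
    rcases le_total
        (μ.real {ω : BondConfig (Fin n) | (A.filter fun y => ω ∈ openConn a y).card ≤ j})
        (μ.real {ω : BondConfig (Fin n) | (A.filter fun y => ω ∈ openConn b' y).card ≤ j}) with h | h
    · exact ⟨b', hb'A, hD.trans (by rw [max_eq_right h])⟩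
    · exact ⟨a, haA, hD.trans (by rw [max_eq_left h])⟩
  · push Not at hlp
    exact cumulativeIsolation_blobs_noLightPair w A o j cls hcls hlp hA

/-- **CIL on every blob structure with at most four labels** (`b ≤ 4`), every `|A|`, every level:
relabel through `Fin.castLE`. [folklore] -/
theorem cumulativeIsolation_blobs_le_four {b : ℕ} (hb : b ≤ 4) :
    ∀ (n : ℕ) (w : Sym2 (Fin n) → unitInterval) (A : Finset (Fin n)) (o : Fin n) (j : ℕ)
      (cls : Fin n → Fin b),
      (∀ u ∈ insert o A, ∀ v ∈ insert o A, cls u = cls v →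
        (Literature.Probability.LatticeModels.prodBernoulli w).real
          (Literature.Probability.Percolation.openConn u v)ᶜ = 0) →
      A.Nonempty →
      ∃ a ∈ A,
        (Literature.Probability.LatticeModels.prodBernoulli w).real
            {ω : Literature.Probability.Percolation.BondConfig (Fin n) |
              1 ≤ (A.filter fun x => ω ∈ Literature.Probability.Percolation.openConn o x).card ∧
                (A.filter fun x => ω ∈ Literature.Probability.Percolation.openConn o x).card ≤ j} ≤
          (Literature.Probability.LatticeModels.prodBernoulli w).real
            {ω : Literature.Probability.Percolation.BondConfig (Fin n) |
              (A.filter fun x => ω ∈ Literature.Probability.Percolation.openConn a x).card ≤ j} := by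
  intro n w A o j cls hcls hA
  exact cumulativeIsolation_fourBlobs n w A o j (Fin.castLE hb ∘ cls)
    (fun u hu v hv huv => hcls u hu v hv (Fin.castLE_injective hb huv)) hA

end Summit.CriticalPhenomena.PercolationContinuityZ3.Theorems

end
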